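/- Copyright: the b2b-balaban cell (near-miss cell 7), T⁴-continuum fan-out; row NE7b CRUX team (2), seat
t4-ne7b-formalise-leaf-03 (gen 28) — custodian's D-50-2′ «THE WEIGHTED PLUG CHAIN», part 3 of the chain: THE RECORD TWIN
`HistReadDataLP` of the OWNER's L4 `HistReadDataL` (p283718) with the ten M5-2c volume fields REPLACED by a weight letter,
its floor and THE VOLUME PLUG display (R-OWNER-51-1 (5) «D-50-2 … ONE record twin»; located point F-ne7bleaf03g28-1).
Released under the licence of the surrounding project. -/
import Summits.QuantumFields.BalabanUV.T4Continuum.Support.HistoryRealiseCellsRunAssemblyWTVSDataL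

/-!
# THE (α) ASSEMBLY, part 1LP: THE BUNDLED INPUTS WITH THE VOLUME LEDGER AS A PLUG AT A DISPLAYED WEIGHT, `HistReadDataLP`
# (D-50-2′ part 3; re-open object (α) of row NE7b; custodian lineage `t4-ne7b-formalise-leaf-03` gen 28)

Summits-side support leaf of the T⁴-continuum cell (rung (B)+1 on a FINITE torus only; NOT infinite volume, NOT the
mass gap, NOT the Clay statement; NOT a proof of the spine estimate NE7b — the cell's OWN estimate, NOT PRINTED, NOT
PROVED).  [folklore] ONE `structure` (a hypothesis SHAPE: data + located displays, NOTHING of Bałaban's asserted); no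
`[cite:]` tag, no `Prop` fact minted, zero `sorry`.  Append-only elsewhere: the owner's `HistReadDataL` (p283718), the
custodian's `HistReadData`∕`HistReadDataLW`∕`HistReadDataLWD` and their assemblies stay, UNCHANGED BY NAME; the carriers
`cellA`∕`memA`∕`physA`∕`kmemA` are the custodian's, IMPORTED.

WHY (F-ne7bleaf03g28-1, journal «INTENT 1 D-50-2′»).  `HistReadDataL` displays the volume ledger in M5-2c's letters — growth
`Lu` over a lag `jl`, `hLu0 hj1 hLu hsmall huΦ huE₂ huE₃` — and books the volume slack `huV` and run B's numerator `upB` at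
the literal class weight `2 ^ (d + 3)`; L5 §1 consumes them through `upM_of_reading'`, whose chain down to M5-2c's
`exp_volume_le_genT` threads the same letters.  M5-2d (`HistoryBankingShrunkWitness`) and M5-2e ((E5) `…82`) prove the SAME
per-component sentence at the weights `cvol d j Γ` ∕ `cvol82 d j Γ` from DIFFERENT displays, so no record over M5-2c's
letters can carry them.  This twin displays instead, per cutoff, a WEIGHT `wV K ≥ 2^{d+3}` and THE PLUG ITSELF — «every
live component's tree volume factor is booked by its tagged genealogy up to the `wV K`-weighted class remainder» — which
each ledger DISCHARGES at the embedding (D-50-2′ part 1 §3: `plug_of_flat`, `plug_of_shrunk`, `plug_of_shrunk82`), and books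
`huV` at `wV K`.  `upB` stays at `2^{d+3}` (every heavier weight is served by `LIVEOf_mono_weight`, part 2 §3).

WHAT.  **`structure HistReadDataLP`** = `HistReadDataL` FIELD FOR FIELD with ONE located hunk and ONE re-weighting: (i) the
ten fields `Lu jl hLu0 hj1 hLu hsmall huΦ huE₂ huE₃` are REPLACED by **`wV : ℕ → ℝ`**, **`hwV : ∀ K, K₀ ≤ K → 2 ^ (d + 3) ≤ wV K`**
and **`hplug`** (the plug at `wV K`, per term of `termSet I K` and live component of its run, in the reading's letters
`ℛ.L`, `ℛ.s K`, `ℛ.R K`); (ii) `huV` is booked at `wV K * log (Φf.Λ K ·)` instead of `2 ^ (d + 3) * …`.  Part 4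
(`HistoryRealiseCellsRunAssemblyWTVSLP`) builds `Nonempty (CountRoadWitnessT3bWTVSL …)` from it at `FcM`∕`uV` of weight `wV`,
embeds `HistReadDataL` (`toLP`, `wV := 2^{d+3}`, plug by `plug_of_flat`) and re-derives L5 §1 through it; part 5 (ON EVENT
(E5) + IR-51-1) embeds `HistReadDataLW` at M5-2e's weight and window.

BY-NAME EFFECT (`WALL-NE7b-P1.md` §2): the rows «volume calibrations» ∕ «volume slack (WS1)» keep their CLASS (K modulo
PREFIX + C-side, supplied at the embedding); the record's volume side becomes LEDGER-AGNOSTIC.  HONEST SCOPE.  A bundling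
of HYPOTHESES; nothing discharged here.  NE7b NOT proved; spine 0∕9.  HONEST DEPENDENCY (cell): continuum YM on T⁴ ⇐
BetaPertH ∧ nine spine estimates (0/9 proved); BetaPertH ⇐ (D1) ∧ (D4) ∧ CAP+tail; G-an2-4 gates asym, D1 and NE2/3/4.
This file changes none of it.
-/

open Finset MeasureTheory
open Literature.MathematicalPhysics.QuantumFieldTheory.Balaban1983to89
open T4PersistenceDictionary T4PersistentHistoryCount T4BankedInduction T4PrintedShapeBanking
open T4WeightBudget T4GlobalDenominator T4LiveClassFibration T4LiveStructureGas T4LiveGasToTerms T4RecordPriceSeam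
open T4PartnerMultiplicity T4IndicatorShell T4MatchingAssembly T4MatchingClosure T4MatchingClosureSocket T4Continuum
open T4StabilitySocket T4BranchingRecordsGas T4TaggedShapeBanking T4CanonicalMenus T4RenewalChains
open Summit.QuantumFields.BalabanUV.T4Continuum.PlacementBatch Summit.QuantumFields.BalabanUV.T4Continuum.PlacementSkeleton
open Summit.QuantumFields.BalabanUV.T4Continuum.CountThresholdUniform Summit.QuantumFields.BalabanUV.T4Continuum.CountThresholdExit
open Summit.QuantumFields.BalabanUV.T4Continuum.CountSeamJunction Summit.QuantumFields.BalabanUV.T4Continuum.LateMergers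
open Summit.QuantumFields.BalabanUV.T4Continuum.HistoryFlow Summit.QuantumFields.BalabanUV.T4Continuum.HistoryRegeneration
open Summit.QuantumFields.BalabanUV.T4Continuum.HistoryTables Summit.QuantumFields.BalabanUV.T4Continuum.HistoryAssemblyTrees
open Summit.QuantumFields.BalabanUV.T4Continuum.HistoryAssemblyTerms Summit.QuantumFields.BalabanUV.T4Continuum.HistoryAssemblyPedigree
open Summit.QuantumFields.BalabanUV.T4Continuum.HistoryConstants Summit.QuantumFields.BalabanUV.T4Continuum.HistoryGen
open Literature.MathematicalPhysics.QuantumFieldTheory.Balaban1983to89.B13ScaleTransfer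
open Summit.QuantumFields.BalabanUV.T4Continuum.ZoneSkeleton Summit.QuantumFields.BalabanUV.T4Continuum.HistorySocketTH
open Summit.QuantumFields.BalabanUV.T4Continuum.HistoryCaps Summit.QuantumFields.BalabanUV.T4Continuum.HistoryAssemblyPrice
open Summit.QuantumFields.BalabanUV.T4Continuum.HistoryBankingLE Summit.QuantumFields.BalabanUV.T4Continuum.HistoryExitLE
open Summit.QuantumFields.BalabanUV.T4Continuum.HistoryAssemblyTreesLE Summit.QuantumFields.BalabanUV.T4Continuum.HistoryAssemblyTermsLE
open Summit.QuantumFields.BalabanUV.T4Continuum.HistoryRealise Summit.QuantumFields.BalabanUV.T4Continuum.HistoryAssemblyRealiseLE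
open Summit.QuantumFields.BalabanUV.T4Continuum.HistoryAssemblyMult Summit.QuantumFields.BalabanUV.T4Continuum.HistoryAssemblyMultKey
open Summit.QuantumFields.BalabanUV.T4Continuum.HistoryAssemblyRealiseRun Summit.QuantumFields.BalabanUV.T4Continuum.HistoryAssemblyRealiseMult
open Summit.QuantumFields.BalabanUV.T4Continuum.HistoryZones Summit.QuantumFields.BalabanUV.T4Continuum.HistoryRealiseCells
open Summit.QuantumFields.BalabanUV.T4Continuum.HistoryRealiseCellsRun Summit.QuantumFields.BalabanUV.T4Continuum.HistoryAssemblyRealiseRunMult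
open Summit.QuantumFields.BalabanUV.T4Continuum.HistoryRealiseCellsRunMult Summit.QuantumFields.BalabanUV.T4Continuum.HistoryAssemblyMultInstance
open Summit.QuantumFields.BalabanUV.T4Continuum.HistoryJoinsPlacedMember Summit.QuantumFields.BalabanUV.T4Continuum.PlacementSkeleton
open Summit.QuantumFields.BalabanUV.T4Continuum.HistoryJoinsPlacedMult Summit.QuantumFields.BalabanUV.T4Continuum.HistoryRealiseDistinct
open Summit.QuantumFields.BalabanUV.T4Continuum.HistoryRegionTemplates Summit.QuantumFields.BalabanUV.T4Continuum.HistoryCaps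
open Summit.QuantumFields.BalabanUV.T4Continuum.HistoryZoneEvolve (cth)
open Literature.MathematicalPhysics.QuantumFieldTheory.Balaban1983to89.B16SProfile (DropCtl)
open Summit.QuantumFields.BalabanUV.T4Continuum.HistoryRealiseCellsRunMultEnd Summit.QuantumFields.BalabanUV.T4Continuum.HistoryRealiseCellsRunMultEndD
open Summit.QuantumFields.BalabanUV.T4Continuum.HistoryRealiseCellsRunPinnedT3b Summit.QuantumFields.BalabanUV.T4Continuum.HistoryHybridRescale
open Summit.QuantumFields.BalabanUV.T4Continuum.HistoryRealiseCellsRunApex (exists_const_schemeZ)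
open Summit.QuantumFields.BalabanUV.T4Continuum.HistoryRealisePrint Summit.QuantumFields.BalabanUV.T4Continuum.HistoryRealiseWeak
open Summit.QuantumFields.BalabanUV.T4Continuum.HistoryRealisePrintReading Summit.QuantumFields.BalabanUV.T4Continuum.HistoryRealiseWeakReading
open Summit.QuantumFields.BalabanUV.T4Continuum.HistoryRealisePrintCells Summit.QuantumFields.BalabanUV.T4Continuum.HistoryRealiseWeakCells
open Summit.QuantumFields.BalabanUV.T4Continuum.HistoryRealiseCellsRunApexT3b Summit.QuantumFields.BalabanUV.T4Continuum.HistoryRealiseCellsRunApexT3bW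

open Summit.QuantumFields.BalabanUV.T4Continuum.HistoryRealiseCellsRunApexT3bWT Summit.QuantumFields.BalabanUV.T4Continuum.HistoryRealiseCellsRunPinnedT3bWT
open Summit.QuantumFields.BalabanUV.T4Continuum.HistoryRealiseCellsRunHeadlineT3bWT
open Summit.QuantumFields.BalabanUV.T4Continuum.HistoryRealiseCellsRunApexT3bWTV Summit.QuantumFields.BalabanUV.T4Continuum.HistoryBankingVolumePlug
open Summit.QuantumFields.BalabanUV.T4Continuum.HistoryRealiseCellsRunApexT3bWTVS
open Summit.QuantumFields.BalabanUV.T4Continuum.HistoryGenealogyRealise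
open Summit.QuantumFields.BalabanUV.T4Continuum.HistoryGenealogyInstantiate
open Summit.QuantumFields.BalabanUV.T4Continuum.B16HistoryIndexedRepr
open Summit.QuantumFields.BalabanUV.T4Continuum.B16HistoryIndexedTrunc
open Summit.QuantumFields.BalabanUV.T4Continuum.HistoryBankingDiscountCharge
open Summit.QuantumFields.BalabanUV.T4Continuum.HistoryBankingCreditRead
open Summit.QuantumFields.BalabanUV.T4Continuum.HistoryBankingFibreRoom
open Summit.QuantumFields.BalabanUV.T4Continuum.HistoryPriceKeys
open Summit.QuantumFields.BalabanUV.T4Continuum.HistoryRealiseCellsRunSupplyWTVS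
open Summit.QuantumFields.BalabanUV.T4Continuum.HistoryRealiseCellsRunSupplyKeysWTVS

open Summit.QuantumFields.BalabanUV.T4Continuum.HistoryRealiseCellsRunAssemblyWTVSData

open Summit.QuantumFields.BalabanUV.T4Continuum.HistoryBankingForestVolume
open Summit.QuantumFields.BalabanUV.T4Continuum.HistoryRealiseCellsRunAssemblyWTVSDataL

namespace Summit.QuantumFields.BalabanUV.T4Continuum.HistoryRealiseCellsRunAssemblyWTVSDataLP

noncomputable section

set_option synthInstance.maxSize 1024

/-! ## The bundled inputs, the volume ledger a plug at a displayed weight -/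

section Data

variable {F : T4Family} {G : Type*} [GaugeGroup G] [MeasurableSpace G] [HaarData G] [RegularGaugeGroup G]

/-- **THE INPUTS OF THE (α) ASSEMBLY WITH THE VOLUME LEDGER AS A PLUG** (D-50-2′; HYPOTHESIS SHAPE — data + located
displays, NOTHING of Bałaban's asserted): the owner's `HistReadDataL` FIELD FOR FIELD, its ten M5-2c volume fields REPLACED
by the class weight `wV` (`≥ 2^{d+3}`) and the per-component volume plug `hplug`, the volume slack `huV` booked at `wV`.
[folklore] -/
structure HistReadDataLP (D : FiniteEpsData F G) (C : T4PrintedShapeBanking.Consts) (O : PrintedO1s) (θv : ℝ)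
    (rr d n : ℕ) (hn : 0 < n) (g₀ : ℕ → ℝ) (os : List (ULoop F)) {DomK : ℕ → Type}
    (I : (K : ℕ) → HIndex (DomK K)) [DecidableEq (HIndex.Idx I)] {DomK' : ℕ → Type} (I' : (K : ℕ) → HIndex (DomK' K))
    (X : ℕ → Type) [∀ K, MeasurableSpace (X K)] (μ : (K : ℕ) → Measure (X K)) [∀ K, IsFiniteMeasure (μ K)]
    (𝒢 : (K : ℕ) → GoodClass (X K)) (Y : ℕ → Type) [∀ K, MeasurableSpace (Y K)] (νB : (K : ℕ) → Measure (Y K))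
    [∀ K, IsFiniteMeasure (νB K)] (𝒢' : (K : ℕ) → GoodClass (Y K)) where
  /-- the source radius -/
  l₀ : ℝ
  /-- the volume factor of the matching remainders -/
  vol : ℝ
  /-- the source radius is positive -/
  l₀_pos : 0 < l₀
  /-- the volume factor is positive -/
  vol_pos : 0 < vol
  /-- the threshold in the number of steps -/
  K₀ : ℕ
  /-- M1∕M2-A: run A's history-indexed operations over the skeleton, per cutoff and source value -/
  RA : (K : ℕ) → ℝ → Repr172R (𝒢 K) (I K)
  /-- M1∕M2-A: run A's dressed density on its reference space -/
  ρA : (K : ℕ) → ℝ → X K → ℝ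
  /-- display ((1.72) holds): the density is the sum of the level's terms -/
  holdsA : ∀ K t V, ρA K t V = ∑ a : (I K).Adm, (RA K t).term a V
  /-- display (integrability of the elementary terms) -/
  intA : ∀ K t a, ∀ ι ∈ (I K).LIdx a, Integrable ((RA K t).eterm a ι) (μ K)
  /-- display (H2: the dressed push-forward identity) -/
  H2A : ∀ K t, |t| ≤ l₀ → K₀ ≤ K →
    ∫ U, Real.exp (t * T4GenFunBounds.prodObs (D.scheme g₀) K os U) * D.dens K (g₀ K) 0 U ∂fieldMeasure (F.P K) 0 G =
      ∫ x, ρA K t x ∂μ K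
  /-- M2-B: the reading of the history choices (regions, classes, cubes; flow, memory) -/
  ℛ : HistReading I d
  /-- (c1) the reading's blocking parameter is the family's -/
  hL : ℛ.L = F.L
  /-- (c1) the reading's exponent profile is the run's own -/
  hs : ℛ.s = runProfile F.L ℛ.R
  /-- M2-B: the factor values and envelopes -/
  Φf : HistFactors I d
  /-- display: THE identification `HistRead` -/
  hR : HistRead ℛ Φf RA l₀ K₀
  /-- display (2.5): the reading's sizes are admissible for the running couplings -/
  isRj : ∀ K s, s ≤ K → B14.IsRj F.L rr ((D.C ⟨K, F.m, g₀ K⟩).flow.g s) (ℛ.R K s)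
  /-- sizes are at least one -/
  one_le_R : ∀ K, K₀ ≤ K → ∀ t, 1 ≤ ℛ.R K t
  /-- flow (K): the blocking parameter is at least four -/
  hL4 : 4 ≤ F.L
  /-- flow (K): the run's own exponent profile is non-increasing within the run (`runProfile_succ_le`) -/
  hprof : ∀ K, K₀ ≤ K → ∀ t, t < K → runProfile F.L ℛ.R K (t + 1) ≤ runProfile F.L ℛ.R K t
  /-- flow (K): drop control of the run's own profile (`dropCtl_runProfile`) -/
  hdrop : ∀ K, K₀ ≤ K → ∀ m, DropCtl (runProfile F.L ℛ.R K) m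
  /-- pass-V input condition per term: new regions consistent -/
  hN : ∀ K, K₀ ≤ K → ∀ τ ∈ HIndex.termSet I K, (ℛ.inputOf.run K τ).NewOK
  /-- pass-V input condition per term: memory domination -/
  hRm : ∀ K, K₀ ≤ K → ∀ τ ∈ HIndex.termSet I K, ∀ t k, (ℛ.inputOf.run K τ).Rm t k ≤ (ℛ.inputOf.run K τ).R t
  /-- pass-V input condition per term: memory domination, one-step form -/
  hRmS : ∀ K, K₀ ≤ K → ∀ τ ∈ HIndex.termSet I K, ∀ t k, (ℛ.inputOf.run K τ).Rm t (k + 1) ≤ (ℛ.inputOf.run K τ).R (t + 1)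
  /-- pass-V input condition per term: non-degenerate memory -/
  hRm2 : ∀ K, K₀ ≤ K → ∀ τ ∈ HIndex.termSet I K, ∀ t, 2 ≤ (ℛ.inputOf.run K τ).Rm t 1
  /-- pass-V input condition per term: disjoint new regions -/
  hD : ∀ K, K₀ ≤ K → ∀ τ ∈ HIndex.termSet I K, (ℛ.inputOf.run K τ).NewDisjoint
  /-- pass-V input condition per term, THE INPUT DISPLAY OF R-OWNER-47-3 ∕ 48-1: every point of every new region lies in
  the torus' period box at its level (`RegionsInBox`; implies the junction's `InBoxOK` and the witness's `BoxedBirths`) -/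
  hreg : ∀ K, K₀ ≤ K → ∀ τ ∈ HIndex.termSet I K, (ℛ.inputOf.run K τ).RegionsInBox n K
  /-- constants: the window constant, the discount letters -/
  hn₁ : 13 ≤ C.n₁
  /-- constants -/
  hE₂ : 0 < C.E₂
  /-- constants -/
  hE₃ : 0 ≤ C.E₃
  /-- D-50-2′: THE CLASS WEIGHT OF THE VOLUME LEDGER, per cutoff (`2^{d+3}` for M5-2c, `cvol d j Γ` for M5-2d,
  `cvol82 d j Γ` for M5-2e — chosen at the embedding) -/
  wV : ℕ → ℝ
  /-- display: the weight is at least the flat one (so run B's `upB`, booked at `2^{d+3}`, serves it by monotonicity) -/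
  hwV : ∀ K, K₀ ≤ K → (2 : ℝ) ^ (d + 3) ≤ wV K
  /-- display (THE VOLUME PLUG, per term and live component of its run, in the reading's letters): the component's tree
  volume factor is booked by its tagged genealogy up to the `wV K`-weighted class remainder — the common conclusion of
  M5-2c `exp_volume_le_genT`, M5-2d `…_shrunk`, M5-2e `…_shrunk82`, DISCHARGED at the embedding, never asserted -/
  hplug : ∀ K, K₀ ≤ K → ∀ τ ∈ HIndex.termSet I K, ∀ x ∈ (ℛ.inputOf.run K τ).histV.comp K,
    Real.exp (treeVol ℛ.L (ℛ.s K) (fun v => (v : ℝ)) (ℛ.inputOf.run K τ).pedMV (fun j => Real.log (Φf.Λ K j)) K (K, x)) ≤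
      Real.exp (lifeCost (dictWT Prod.fst (ℛ.R K) C.n₁) (costT Prod.fst C K (ℛ.R K))
          ((ℛ.inputOf.run K τ).pedMV.genT (K, x))) *
        Real.exp (birthWT Prod.fst (fun n => wV K * Real.log (Φf.Λ K n)) ((ℛ.inputOf.run K τ).pedMV.genT (K, x)))
  /-- M5-3∕M5-4 letters per cutoff: sharp birth exponents -/
  sB : ℕ → ℕ → ℕ → ℝ
  /-- sharp renewal exponents -/
  sR : ℕ → ℕ → ℝ
  /-- fibre shares, births -/
  φB : ℕ → ℕ → ℕ → ℝ
  /-- fibre shares, renewals -/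
  φR : ℕ → ℕ → ℝ
  /-- (2.9)'s letters -/
  β' : ℝ
  /-- (2.9)'s letters -/
  β₀ : ℝ
  /-- display: the factor reading -/
  hF : ∀ K, K₀ ≤ K → FactorRead (Φf.fB K) (Φf.fR K) (sB K) (sR K)
  /-- display: the rounding-with-room junction with the fibre share booked -/
  hRR : ∀ K, K₀ ≤ K → RoundingRoomF C O F.L K (ℛ.R K) (D.C ⟨K, F.m, g₀ K⟩).flow.g (sB K) (sR K) (φB K) (φR K)
  /-- display (2.9) on the reading's sizes -/
  h29 : ∀ K, K₀ ≤ K → B14FlowStep.FlowIneq29 (ℛ.R K) (D.C ⟨K, F.m, g₀ K⟩).flow.g F.L β' β₀ K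
  /-- display (D-V1, the volume slack AT THE LEDGER's WEIGHT): `wV K·log Λ K j ≤ θᵥ·p₀(g_j)²` at the priced members' births -/
  huV : ∀ K, K₀ ≤ K → ∀ τ ∈ badTerms (memA n F.L ℛ) jhalf (HIndex.termSet I) K, ∀ q ∈ memA n F.L ℛ K τ,
    ∀ e ∈ q.2.events, (Prod.fst e).kind = 0 →
      wV K * Real.log (Φf.Λ K (Prod.fst e).step) ≤
        θv * p0Profile C.A₀ C.p₀ ((D.C ⟨K, F.m, g₀ K⟩).flow.g (Prod.fst e).step) ^ 2
  /-- the term-free curly normalisation envelope -/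
  W : ℕ → ℝ
  /-- display -/
  one_le_W : ∀ K, 1 ≤ W K
  /-- the term-free envelopes' K-uniform bounds -/
  (Wi BAi mi : ℝ)
  /-- display -/
  hWi : ∀ K, W K ≤ Wi
  /-- display -/
  hBA : ∀ K t, |t| ≤ l₀ → K₀ ≤ K → Φf.BA K t ≤ BAi
  /-- display -/
  hmi : ∀ K, (μ K).real Set.univ ≤ mi
  /-- display (ρ) `FibreMass` (located, VOLUME type) -/
  hρ : ∀ K t, |t| ≤ l₀ → K₀ ≤ K →
    ∀ k ∈ badGMems (memA n F.L ℛ) jhalf (HIndex.termSet I) (kmemA n F.L hn (lt_of_lt_of_le (by norm_num) (two_le_L F)) ℛ) K,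
      ∑ τ ∈ fibre (kmemA n F.L hn (lt_of_lt_of_le (by norm_num) (two_le_L F)) ℛ) (HIndex.termSet I) K k,
        dmassOf ℛ Φf t τ ≤ W K * MULTOf (sharpT (φB K) (φR K)) k
  /-- the (γ) small-field mass floor -/
  c₀ : ℝ
  /-- the site budget -/
  n₁ : ℝ
  /-- the floor is positive -/
  c₀_pos : 0 < c₀
  /-- (γ) floor, run A -/
  floor : ∀ K, K₀ ≤ K → c₀ ≤ smallFieldMass D K (g₀ K)
  /-- (γ) floor, run B -/
  floor' : ∀ K, K₀ ≤ K → c₀ ≤ smallFieldMass D (K + 1) (g₀ (K + 1))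
  /-- site budget, run A -/
  sites : ∀ K, K₀ ≤ K → ((D.C ⟨K, F.m, g₀ K⟩).numSites K : ℝ) ≤ n₁
  /-- site budget, run B -/
  sites' : ∀ K, K₀ ≤ K → ((D.C ⟨K + 1, F.m, g₀ (K + 1)⟩).numSites (K + 1) : ℝ) ≤ n₁
  /-- RUN B v0.5: run B's history-indexed operations over ITS skeleton, per cutoff and source value -/
  RB : (K : ℕ) → ℝ → Repr172R (𝒢' K) (I' K)
  /-- RUN B: run B's dressed density after `K + 1` steps on its reference space -/
  ρB : (K : ℕ) → ℝ → Y (K + 1) → ℝ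
  /-- display ((1.72) holds for run B at cutoff `K + 1`) -/
  holdsB : ∀ K t V, ρB K t V = ∑ a : (I' (K + 1)).Adm, (RB (K + 1) t).term a V
  /-- display (integrability, run B) -/
  intB : ∀ K t a, ∀ ι ∈ (I' (K + 1)).LIdx a, Integrable ((RB (K + 1) t).eterm a ι) (νB (K + 1))
  /-- display (H2, run B) -/
  H2B : ∀ K t, |t| ≤ l₀ → K₀ ≤ K →
    ∫ U, Real.exp (t * T4GenFunBounds.prodObs (D.scheme g₀) (K + 1) os U) * D.dens (K + 1) (g₀ (K + 1)) 0 U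
        ∂fieldMeasure (F.P (K + 1)) 0 G = ∫ y, ρB K t y ∂νB (K + 1)
  /-- RUN B (S, NODE O): the truncation of run B's level-`(K+1)` terms onto run A's index -/
  trunc : ℕ → HIndex.Idx I' → HIndex.Idx I
  /-- display (S): the truncation maps run B's term set into run A's -/
  htr : ∀ K, K₀ ≤ K → ∀ τ' ∈ HIndex.termSet I' (K + 1), trunc K τ' ∈ HIndex.termSet I K
  /-- RUN B: per-term dead weights -/
  dB : ℕ → ℝ → HIndex.Idx I' → ℝ
  /-- RUN B: envelope -/
  mup : ℕ → ℝ → ℝ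
  /-- RUN B: sharp ∕ share letters of run B -/
  (sB' φB' : ℕ → ℕ → ℕ → ℝ)
  /-- RUN B: sharp ∕ share letters of run B -/
  (sR' φR' : ℕ → ℕ → ℝ)
  /-- display: the booked junction at run B's letters (for `priceM′` at run A's key) -/
  hRR' : ∀ K, K₀ ≤ K → RoundingRoomF C O F.L K (ℛ.R K) (D.C ⟨K, F.m, g₀ K⟩).flow.g (sB' K) (sR' K) (φB' K) (φR' K)
  /-- display (R «TRUNC»): run B's numerator reading per term, KEYED AT RUN A's KEYS -/
  upB : ∀ K t, |t| ≤ l₀ → K₀ ≤ K →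
    ∀ k ∈ badGMems (memA n F.L ℛ) jhalf (HIndex.termSet I) (kmemA n F.L hn (lt_of_lt_of_le (by norm_num) (two_le_L F)) ℛ) K,
      ∀ τ' ∈ HIndex.termSet I' (K + 1),
        trunc K τ' ∈ fibre (kmemA n F.L hn (lt_of_lt_of_le (by norm_num) (two_le_L F)) ℛ) (HIndex.termSet I) K k →
          Repr172R.weight νB RB t τ' ≤
            dB K t τ' * LIVEOf C K (ℛ.R K) (fun m => 2 ^ (d + 3) * Real.log (Φf.Λ K m)) (sharpT (sB' K) (sR' K)) k *
              mup K t
  /-- display (R «TRUNC»): run B's dead weights are nonnegative over the composite fibres -/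
  deadB_nonneg : ∀ K t, |t| ≤ l₀ → K₀ ≤ K →
    ∀ k ∈ badGMems (memA n F.L ℛ) jhalf (HIndex.termSet I) (kmemA n F.L hn (lt_of_lt_of_le (by norm_num) (two_le_L F)) ℛ) K,
      ∀ τ' ∈ HIndex.termSet I' (K + 1),
        trunc K τ' ∈ fibre (kmemA n F.L hn (lt_of_lt_of_le (by norm_num) (two_le_L F)) ℛ) (HIndex.termSet I) K k →
          0 ≤ dB K t τ'
  /-- display (ρ′) (located, VOLUME type): run B's fibre mass over the COMPOSITE fibre of a key -/
  resumB : ∀ K t, |t| ≤ l₀ → K₀ ≤ K →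
    ∀ k ∈ badGMems (memA n F.L ℛ) jhalf (HIndex.termSet I) (kmemA n F.L hn (lt_of_lt_of_le (by norm_num) (two_le_L F)) ℛ) K,
      ∑ τ' ∈ (HIndex.termSet I' (K + 1)).filter (fun τ' =>
          trunc K τ' ∈ fibre (kmemA n F.L hn (lt_of_lt_of_le (by norm_num) (two_le_L F)) ℛ) (HIndex.termSet I) K k),
        dB K t τ' ≤ MULTOf (sharpT (φB' K) (φR' K)) k
  /-- display: run B's envelope bound (at `Nup := e^{BA∞}·m∞·W∞`) -/
  mup_bd : ∀ K t, |t| ≤ l₀ → K₀ ≤ K → 0 ≤ mup K t ∧ mup K t ≤ Real.exp BAi * mi * Wi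
  /-- NE7c: the two runs' shell parts -/
  (shA shB : ℕ → ℝ → HIndex.Idx I → ℝ)
  /-- NE7c's shell weight budget -/
  Wsh : ℕ → ℝ
  /-- NE7c (S): the indicator shells' relative weight bound over this reading's terms -/
  shell : ShellWeightBound l₀ (HIndex.termSet I) (fun _ t => Repr172R.weight μ RA t) (weightB νB RB trunc) shA shB Wsh
  /-- NE7 core budget data -/
  (Cc Rr CcRec RrRec : ℕ → ℝ → HIndex.Idx I → ℝ)
  /-- NE7 core budget rates -/
  (ν u s₂ q₀ r s : ℕ → ℝ)
  /-- NE7 (S): the re-indexed per-term budget over this reading's bad classes -/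
  budget : ReindexedBudget l₀ vol (HIndex.termSet I) (fun K t τ => Repr172R.weight μ RA t τ - shA K t τ)
    (fun K t τ => weightB νB RB trunc K t τ - shB K t τ)
    (badOfClass (bstrOf Prod.fst (memA n F.L ℛ)) (HIndex.termSet I)
      (fun K _ => badClasses Prod.fst (memA n F.L ℛ) jhalf (HIndex.termSet I) K)) Cc Rr CcRec RrRec ν u s₂ q₀ r s
  /-- summable rates -/
  sum_r : Summable r
  /-- summable rates -/
  sum_u : Summable u
  /-- summable rates -/
  sum_s : Summable s
  /-- summable rates -/
  sum_s₂ : Summable s₂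

end Data

end

end Summit.QuantumFields.BalabanUV.T4Continuum.HistoryRealiseCellsRunAssemblyWTVSDataLP
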